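import Literature.LinearAlgebra.Subspace.SpanPairCount
import HarnessLib

/-!
# Cones of three families of punctured subspaces ("frames"): cardinality and the line lemma

Topic `LinearAlgebra/Subspace`; the frame (arbitrary-dimension) version of
`PuncturedLineCones.lean`.  For triples of subspaces `(Vᵢ, Wᵢ, Uᵢ)_{i<N}` of a finite vector
space `X` over a finite field `F` (`q = |F|`) with punctured parts `Aᵢ = Vᵢ ∖ 0`, `Bᵢ = Wᵢ ∖ 0`,
`Cᵢ = Uᵢ ∖ 0`, consider the colour cones `𝒮 = ⋃ᵢ (Aᵢ − Bᵢ)`, `𝒯 = ⋃ᵢ (Bᵢ − Cᵢ)`,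
`𝒰 = ⋃ᵢ (Cᵢ − Aᵢ)`.

* `card_cone_eq_sum` — if `Vᵢ ∩ Wᵢ = 0` and the sets `Aᵢ − Bᵢ` are pairwise disjoint then
  `|𝒮| = Σᵢ |Aᵢ| |Bᵢ|`;
* `cover_of_zeroSum` — the LINE LEMMA for frames: if each triple is direct
  (`v + w + u = 0 ⇒ v = w = u = 0`) and the cones have the zero-sum property
  (`x + y + z = 0`, `x ∈ Aᵢ − Bᵢ`, `y ∈ Bⱼ − Cⱼ`, `z ∈ C_k − A_k` forces `i = j = k`; this is the
  simultaneous triple product property of the frame family), then every plane through the origin has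
  `≤ q − 1` vectors of `𝒮`, or `≤ q − 1` of `𝒯`, or `≤ 3(q − 1)` of `𝒰` — the cover hypothesis of
  `Literature.LinearAlgebra.Subspace.card_mul_lt_of_cover` (`SpanPairCover.lean`).

No definition; finsets characterised by membership.  Written for the matrix-multiplication summit
(route `AlgebraicSTPPDichotomy`, crux `FrameBarrier`); elementary linear algebra, proved here.
-/

open Submodule Finset

namespace Literature.LinearAlgebra.Subspace

variable {F X : Type*} [Field F] [AddCommGroup X] [Module F X] [DecidableEq X] {N : ℕ}

/-- **The cone `⋃ᵢ (Aᵢ − Bᵢ)` of a frame family has `Σᵢ |Aᵢ| |Bᵢ|` vectors** when `Vᵢ ∩ Wᵢ = 0`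
(so `(v, w) ↦ v − w` is injective on `Vᵢ × Wᵢ`) and the sets `Aᵢ − Bᵢ` are pairwise disjoint.
[folklore] -/
theorem card_cone_eq_sum (V W : Fin N → Submodule F X) (A B : Fin N → Finset X)
    (hA : ∀ i x, x ∈ A i ↔ x ∈ V i ∧ x ≠ 0) (hB : ∀ i x, x ∈ B i ↔ x ∈ W i ∧ x ≠ 0)
    (hVW : ∀ i (v : X), v ∈ V i → v ∈ W i → v = 0)
    (hdisj : ∀ (i k : Fin N), ∀ v ∈ A i, ∀ w ∈ B i, ∀ v' ∈ A k, ∀ w' ∈ B k,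
      v - w = v' - w' → i = k)
    (ES : Finset X) (hES : ∀ x, x ∈ ES ↔ ∃ i, ∃ v ∈ A i, ∃ w ∈ B i, x = v - w) :
    ES.card = ∑ i, (A i).card * (B i).card := by
  classical
  set f : X × X → X := fun p => p.1 - p.2 with hf
  have hESe : ES = (univ : Finset (Fin N)).biUnion (fun i => (A i ×ˢ B i).image f) := by
    ext x
    simp only [hES, mem_biUnion, mem_univ, true_and, mem_image, mem_product, Prod.exists, hf]
    constructor
    · rintro ⟨i, v, hv, w, hw, rfl⟩
      exact ⟨i, v, w, ⟨hv, hw⟩, rfl⟩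
    · rintro ⟨i, v, w, ⟨hv, hw⟩, rfl⟩
      exact ⟨i, v, hv, w, hw, rfl⟩
  have hinj : ∀ i, Set.InjOn f (A i ×ˢ B i : Finset (X × X)) := by
    rintro i ⟨v, w⟩ hvw ⟨v', w'⟩ hvw' h
    simp only [coe_product, Set.mem_prod, mem_coe] at hvw hvw'
    simp only [hf] at h
    have h1 : v - v' ∈ V i := sub_mem ((hA i v).1 hvw.1).1 ((hA i v').1 hvw'.1).1
    have h2 : v - v' ∈ W i := by
      have : v - v' = w - w' := by rw [sub_eq_sub_iff_sub_eq_sub] at h; exact h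
      rw [this]
      exact sub_mem ((hB i w).1 hvw.2).1 ((hB i w').1 hvw'.2).1
    have h3 : v - v' = 0 := hVW i _ h1 h2
    have hv : v = v' := sub_eq_zero.1 h3
    subst hv
    have hw : w = w' := by
      have := h
      rwa [sub_right_inj] at this
    subst hw
    rfl
  rw [hESe, card_biUnion]
  · exact sum_congr rfl (fun i _ => by rw [card_image_of_injOn (hinj i), card_product])
  · intro i _ k _ hik
    rw [Function.onFun, disjoint_left]
    intro x hxi hxk
    rw [mem_image] at hxi hxk
    obtain ⟨⟨v, w⟩, hvw, rfl⟩ := hxi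
    obtain ⟨⟨v', w'⟩, hvw', h⟩ := hxk
    simp only [mem_product] at hvw hvw'
    simp only [hf] at h
    exact hik (hdisj i k v hvw.1 w hvw.2 v' hvw'.1 w' hvw'.2 h.symm)

/-- **Line lemma for three families of punctured subspaces.**  Let `(Vᵢ, Wᵢ, Uᵢ)_{i<N}` be direct
triples of subspaces of `X` (`hdir`) with punctured parts `Aᵢ, Bᵢ, Cᵢ`, whose colour cones have the
zero-sum property (`hzero`): `(v − w) + (w' − u) + (u' − v') = 0` with `v ∈ Aᵢ, w ∈ Bᵢ, w' ∈ Bⱼ,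
u ∈ Cⱼ, u' ∈ C_k, v' ∈ A_k` forces `i = j = k`.  Then every plane `L = span{v₀, w₀}` through the
origin has at most `q − 1` vectors of `𝒮 = ⋃ (Aᵢ − Bᵢ)`, or at most `q − 1` of `𝒯 = ⋃ (Bᵢ − Cᵢ)`,
or at most `3(q − 1)` of `𝒰 = ⋃ (Cᵢ − Aᵢ)`.  Proof: as for lines — pick `x ∈ 𝒮 ∩ L`, `y ∈ 𝒯 ∩ L`
independent; any `z ∈ 𝒰 ∩ L` off the lines of `x, y` is `α x + β y` (`α β ≠ 0`) and the cones are
closed under `F^×`, so `hzero` forces its index to be that of `x` and `y`; two independent such `z`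
span `L`, putting `x = v − w` inside `Uᵢ + Vᵢ`, i.e. `w ∈ Wᵢ ∩ (Vᵢ + Uᵢ) = 0` — contradiction.
(Elementary; proved here.) [folklore] -/
theorem cover_of_zeroSum [Fintype F] [Fintype X] (V W U : Fin N → Submodule F X) (A B C : Fin N → Finset X)
    (hA : ∀ i x, x ∈ A i ↔ x ∈ V i ∧ x ≠ 0) (hB : ∀ i x, x ∈ B i ↔ x ∈ W i ∧ x ≠ 0)
    (hC : ∀ i x, x ∈ C i ↔ x ∈ U i ∧ x ≠ 0)
    (hdir : ∀ i (v w u : X), v ∈ V i → w ∈ W i → u ∈ U i → v + w + u = 0 →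
      v = 0 ∧ w = 0 ∧ u = 0)
    (hzero : ∀ (i j k : Fin N), ∀ v ∈ A i, ∀ w ∈ B i, ∀ w' ∈ B j, ∀ u ∈ C j, ∀ u' ∈ C k,
      ∀ v' ∈ A k, (v - w) + (w' - u) + (u' - v') = 0 → i = j ∧ j = k)
    (ES ET EU : Finset X)
    (hES : ∀ x, x ∈ ES ↔ ∃ i, ∃ v ∈ A i, ∃ w ∈ B i, x = v - w)
    (hET : ∀ x, x ∈ ET ↔ ∃ i, ∃ w ∈ B i, ∃ u ∈ C i, x = w - u)
    (hEU : ∀ x, x ∈ EU ↔ ∃ i, ∃ u ∈ C i, ∃ v ∈ A i, x = u - v)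
    (v₀ w₀ : X) (L : Finset X) (hv₀ : v₀ ≠ 0) (hw₀ : w₀ ∉ span F ({v₀} : Set X))
    (hL : ∀ x, x ∈ L ↔ x ∈ span F ({v₀, w₀} : Set X)) :
    (ES ∩ L).card + 1 ≤ Fintype.card F ∨ (ET ∩ L).card + 1 ≤ Fintype.card F ∨
      (EU ∩ L).card + 3 ≤ 3 * Fintype.card F := by
  classical
  set q := Fintype.card F with hq
  have h1q : 1 < q := Fintype.one_lt_card
  by_contra hcon
  push Not at hcon
  obtain ⟨hcS, hcT, hcU⟩ := hcon
  -- scaled membership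
  have smulA : ∀ i (α : F) (v : X), α ≠ 0 → v ∈ A i → α • v ∈ A i := fun i α v hα hv =>
    (hA i _).2 ⟨smul_mem _ _ ((hA i v).1 hv).1, smul_ne_zero hα ((hA i v).1 hv).2⟩
  have smulB : ∀ i (α : F) (v : X), α ≠ 0 → v ∈ B i → α • v ∈ B i := fun i α v hα hv =>
    (hB i _).2 ⟨smul_mem _ _ ((hB i v).1 hv).1, smul_ne_zero hα ((hB i v).1 hv).2⟩
  have smulC : ∀ i (α : F) (v : X), α ≠ 0 → v ∈ C i → α • v ∈ C i := fun i α v hα hv =>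
    (hC i _).2 ⟨smul_mem _ _ ((hC i v).1 hv).1, smul_ne_zero hα ((hC i v).1 hv).2⟩
  -- 0 is in none of the three sets
  have h0S : ∀ x ∈ ES, x ≠ 0 := by
    intro x hx h0
    obtain ⟨i, v, hv, w, hw, rfl⟩ := (hES x).1 hx
    obtain ⟨hvV, hv0⟩ := (hA i v).1 hv
    obtain ⟨hwW, -⟩ := (hB i w).1 hw
    have := hdir i v (-w) 0 hvV (neg_mem hwW) (zero_mem _) (by rw [add_zero, ← sub_eq_add_neg, h0])
    exact hv0 this.1
  have h0T : ∀ x ∈ ET, x ≠ 0 := by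
    intro x hx h0
    obtain ⟨i, w, hw, u, hu, rfl⟩ := (hET x).1 hx
    obtain ⟨hwW, hw0⟩ := (hB i w).1 hw
    obtain ⟨huU, -⟩ := (hC i u).1 hu
    have := hdir i 0 w (-u) (zero_mem _) hwW (neg_mem huU) (by rw [zero_add, ← sub_eq_add_neg, h0])
    exact hw0 this.2.1
  have h0U : ∀ x ∈ EU, x ≠ 0 := by
    intro x hx h0
    obtain ⟨i, u, hu, v, hv, rfl⟩ := (hEU x).1 hx
    obtain ⟨huU, hu0⟩ := (hC i u).1 hu
    obtain ⟨hvV, -⟩ := (hA i v).1 hv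
    have := hdir i (-v) 0 u (neg_mem hvV) (zero_mem _) huU (by rw [add_zero, add_comm, ← sub_eq_add_neg, h0])
    exact hu0 this.2.2
  -- helper: a subset of a line avoiding 0 has ≤ q - 1 elements
  have hline : ∀ (x : X), x ≠ 0 → ∀ (S : Finset X), (∀ z ∈ S, z ≠ 0) →
      (∀ z ∈ S, z ∈ span F ({x} : Set X)) → S.card ≤ q - 1 := by
    intro x hx S h0 hS
    have hsub : S ⊆ (univ.filter (fun z : X => z ∈ span F ({x} : Set X))).erase 0 := by
      intro z hz
      simp only [mem_erase, mem_filter, mem_univ, true_and]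
      exact ⟨h0 z hz, hS z hz⟩
    refine (card_le_card hsub).trans ?_
    rw [card_erase_of_mem (by simp), card_eq_of_mem_iff_mem_span_singleton (F := F) hx _
      (fun z => by simp)]
  -- Step A: x ∈ ES ∩ L, y ∈ ET ∩ L with y ∉ span{x}
  obtain ⟨x, hx⟩ : (ES ∩ L).Nonempty := by
    rw [← card_pos]; omega
  rw [mem_inter] at hx
  have hx0 : x ≠ 0 := h0S x hx.1
  obtain ⟨i, v, hv, w, hw, hxdef⟩ := (hES x).1 hx.1
  obtain ⟨y, hy, hyx⟩ : ∃ y ∈ ET ∩ L, y ∉ span F ({x} : Set X) := by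
    by_contra hall
    push Not at hall
    have := hline x hx0 _ (fun z hz => h0T z (mem_inter.1 hz).1) hall
    omega
  rw [mem_inter] at hy
  have hy0 : y ≠ 0 := h0T y hy.1
  obtain ⟨j, w', hw', u, hu, hydef⟩ := (hET y).1 hy.1
  -- Step B: L is the span of x and y
  have hLxy : ∀ z, z ∈ L → z ∈ span F ({x, y} : Set X) := by
    set Lxy : Finset X := univ.filter (fun z => z ∈ span F ({x, y} : Set X)) with hLxy'
    have hsub : Lxy ⊆ L := subset_of_mem_span_pair ((hL x).1 hx.2) ((hL y).1 hy.2) L Lxy hL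
      (fun z => by simp [hLxy'])
    have hcard : L.card ≤ Lxy.card := by
      rw [card_eq_sq_of_mem_iff_mem_span_pair (F := F) hv₀ hw₀ L hL,
        card_eq_sq_of_mem_iff_mem_span_pair (F := F) hx0 hyx Lxy (fun z => by simp [hLxy'])]
    have heq := eq_of_subset_of_card_le hsub hcard
    intro z hz
    rw [← heq] at hz
    simpa [hLxy'] using hz
  -- Step D: every z ∈ EU ∩ L off the lines of x and y forces i = j = k
  have hstepD : ∀ z ∈ EU ∩ L, z ∉ span F ({x} : Set X) → z ∉ span F ({y} : Set X) →
      ∀ (k : Fin N), ∀ u' ∈ C k, ∀ v' ∈ A k, z = u' - v' → i = j ∧ j = k := by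
    intro z hz hzx hzy k u' hu' v' hv' hzdef
    have hz' := hLxy z (mem_inter.1 hz).2
    rw [mem_span_pair] at hz'
    obtain ⟨α, β, hαβ⟩ := hz'
    have hα : α ≠ 0 := by
      rintro rfl
      apply hzy
      rw [← hαβ, zero_smul, zero_add]
      exact smul_mem _ _ (mem_span_singleton_self y)
    have hβ : β ≠ 0 := by
      rintro rfl
      apply hzx
      rw [← hαβ, zero_smul, add_zero]
      exact smul_mem _ _ (mem_span_singleton_self x)
    refine hzero i j k ((-α) • v) (smulA i _ _ (neg_ne_zero.2 hα) hv) ((-α) • w)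
      (smulB i _ _ (neg_ne_zero.2 hα) hw) ((-β) • w') (smulB j _ _ (neg_ne_zero.2 hβ) hw')
      ((-β) • u) (smulC j _ _ (neg_ne_zero.2 hβ) hu) u' hu' v' hv' ?_
    rw [← hzdef, ← smul_sub, ← smul_sub, ← hxdef, ← hydef, ← hαβ]
    module
  -- Step C: at least q vectors of EU ∩ L off the two lines
  set Z : Finset X := (EU ∩ L).filter (fun z => z ∉ span F ({x} : Set X) ∧
    z ∉ span F ({y} : Set X)) with hZ
  have hZcard : q ≤ Z.card := by
    have hsplit := card_filter_add_card_filter_not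
      (s := EU ∩ L) (fun z => z ∉ span F ({x} : Set X) ∧ z ∉ span F ({y} : Set X))
    have hrest : ((EU ∩ L).filter (fun z => ¬ (z ∉ span F ({x} : Set X) ∧
        z ∉ span F ({y} : Set X)))).card ≤ (q - 1) + (q - 1) := by
      have hsub : (EU ∩ L).filter (fun z => ¬ (z ∉ span F ({x} : Set X) ∧
          z ∉ span F ({y} : Set X))) ⊆
          (EU ∩ L).filter (fun z => z ∈ span F ({x} : Set X)) ∪
          (EU ∩ L).filter (fun z => z ∈ span F ({y} : Set X)) := by
        intro z hz
        simp only [mem_filter, mem_union, not_and_or, not_not] at hz ⊢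
        tauto
      refine (card_le_card hsub).trans ((card_union_le _ _).trans (add_le_add ?_ ?_))
      · refine hline x hx0 _ (fun z hz => h0U z (mem_inter.1 (mem_filter.1 hz).1).1) ?_
        intro z hz; exact (mem_filter.1 hz).2
      · refine hline y hy0 _ (fun z hz => h0U z (mem_inter.1 (mem_filter.1 hz).1).1) ?_
        intro z hz; exact (mem_filter.1 hz).2
    rw [hZ]
    omega
  -- Step E: two independent elements of Z
  obtain ⟨z₀, hz₀⟩ : Z.Nonempty := by rw [← card_pos]; omega
  have hz₀' := mem_filter.1 hz₀
  have hz₀0 : z₀ ≠ 0 := h0U z₀ (mem_inter.1 hz₀'.1).1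
  obtain ⟨z₁, hz₁, hz₁₀⟩ : ∃ z₁ ∈ Z, z₁ ∉ span F ({z₀} : Set X) := by
    by_contra hall
    push Not at hall
    have := hline z₀ hz₀0 Z (fun z hz => h0U z (mem_inter.1 (mem_filter.1 hz).1).1) hall
    omega
  have hz₁' := mem_filter.1 hz₁
  obtain ⟨k₀, u₀, hu₀, v₀', hv₀', hz₀def⟩ := (hEU z₀).1 (mem_inter.1 hz₀'.1).1
  obtain ⟨k₁, u₁, hu₁, v₁', hv₁', hz₁def⟩ := (hEU z₁).1 (mem_inter.1 hz₁'.1).1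
  obtain ⟨hij, hjk₀⟩ := hstepD z₀ hz₀'.1 hz₀'.2.1 hz₀'.2.2 k₀ u₀ hu₀ v₀' hv₀' hz₀def
  obtain ⟨-, hjk₁⟩ := hstepD z₁ hz₁'.1 hz₁'.2.1 hz₁'.2.2 k₁ u₁ hu₁ v₁' hv₁' hz₁def
  -- Step F: x lies in span{z₀, z₁} ⊆ Uᵢ + Vᵢ: contradiction with directness
  have hxz : x ∈ span F ({z₀, z₁} : Set X) := by
    set Lz : Finset X := univ.filter (fun z => z ∈ span F ({z₀, z₁} : Set X)) with hLz'
    have hsub : Lz ⊆ L := subset_of_mem_span_pair ((hL z₀).1 (mem_inter.1 hz₀'.1).2)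
      ((hL z₁).1 (mem_inter.1 hz₁'.1).2) L Lz hL (fun z => by simp [hLz'])
    have hcard : L.card ≤ Lz.card := by
      rw [card_eq_sq_of_mem_iff_mem_span_pair (F := F) hv₀ hw₀ L hL,
        card_eq_sq_of_mem_iff_mem_span_pair (F := F) hz₀0 hz₁₀ Lz (fun z => by simp [hLz'])]
    have heq := eq_of_subset_of_card_le hsub hcard
    have := hx.2
    rw [← heq] at this
    simpa [hLz'] using this
  rw [mem_span_pair] at hxz
  obtain ⟨lam, mu, hlm⟩ := hxz
  subst hjk₀ hjk₁
  subst hij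
  -- x = lam • (u₀ - v₀') + mu • (u₁ - v₁') = v - w
  obtain ⟨hvV, -⟩ := (hA i v).1 hv
  obtain ⟨hwW, hw0⟩ := (hB i w).1 hw
  have hu₀U := ((hC i u₀).1 hu₀).1
  have hu₁U := ((hC i u₁).1 hu₁).1
  have hv₀V := ((hA i v₀').1 hv₀').1
  have hv₁V := ((hA i v₁').1 hv₁').1
  have key := hdir i (v + (lam • v₀' + mu • v₁')) (-w) (-(lam • u₀ + mu • u₁))
    (add_mem hvV (add_mem (smul_mem _ _ hv₀V) (smul_mem _ _ hv₁V))) (neg_mem hwW)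
    (neg_mem (add_mem (smul_mem _ _ hu₀U) (smul_mem _ _ hu₁U)))
    (by
      have : lam • (u₀ - v₀') + mu • (u₁ - v₁') = v - w := by rw [← hz₀def, ← hz₁def, hlm, hxdef]
      linear_combination (norm := module) (-1 : F) • this)
  exact hw0 (neg_eq_zero.1 key.2.1)

end Literature.LinearAlgebra.Subspace
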